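import Mathlib
import Summits.Ventures.HodgeRepro.Tier4.Target
import Summits.Ventures.HodgeRepro.Tier4.Line3.KMDatum
import Summits.Ventures.HodgeRepro.Tier4.Line3.KMDatumS
import Summits.Ventures.HodgeRepro.Tier4.Line3.Defs
import Summits.Ventures.HodgeRepro.Tier4.Line3.DefsLemmas

/-!
# Tier4/Line3/LocalizerRemainder — the sum clause of the assembly from positivity at ONE orbit and a REMAINDER bound
(t4-x2 g2, bus S13519 (3): the honest shape of the positivity residual after O-L3-8)

Blind re-derivation cell `pub-hodge-repro`, Tier 4 «PROVE THE STEP» (README §9–§10), LINE L3, seat t4-x2 (reserve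
wall-breaker, g2).  Mathlib-level, on the abstract `OrbitExpansion Orbit pairing term` of `Tier4/Line3/Defs.lean`.

`LocalizerSumOff` (`Tier4/Line3/LocalizerSetOff.lean`, p679551) asks for `main_sum_lower`: the real part of the sum of
the terms over the main set is eventually `≥ m > 0`.  On the natural data the main set is the per-slot scalar family of
the ray (p679898), whose members other than the main orbit carry phases (unramified geometric sums, archimedean
bidegrees — S13495, S13519 (1)) and are NOT termwise positive; what the data give instead is POSITIVITY AT THE MAIN ORBIT
(`pos` on the main classes, `term_main_lower`) and a REMAINDER bound: for a centre of large balanced definite size the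
family minus the main orbit is Gaussian-damped, uniformly in the depth (S13519 (2)).  This module is the bookkeeping:

* `re_tsum_indicator_ge`: at one level and translate, if `m ≤ Re (term main)` and the family minus `main` has norm
  `≤ (1/2) · Re (term main)`, then `m / 2 ≤ Re Σ_{o ∈ A} term o`.
* `main_sum_lower_of_remainder`: the eventual form — exactly the field `LocalizerSumOff.main_sum_lower` for
  `mainSet := A`.

Nothing here asserts anything about the truth of (P); whether the natural data satisfy the remainder bound is the
re-planned line's displayed input.  HC_CM is NOT proved by anyone in this repository.
-/

set_option autoImplicit false

noncomputable section

namespace Summit.Ventures.HodgeRepro.Tier4.Line3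

open Summit.Ventures.HodgeRepro.Tier4
open Filter Topology

open scoped Classical

section Assembly

variable {Level : Type} {Tr : Level → Type}

namespace OrbitExpansion

variable {Orbit : Type} {pairing : ∀ K : Level, Tr K → ℂ} {term : ∀ K : Level, Tr K → Orbit → ℂ}

/-- The summand restricted to a set is summable (a restriction of the expansion's summand). -/
theorem summable_indicator (E : OrbitExpansion Orbit pairing term) (K : Level) (γ : Tr K) (A : Set Orbit) :
    Summable (fun o : Orbit => if o ∈ A then term K γ o else 0) := by
  refine Summable.of_norm_bounded (E.summable_norm K γ) ?_
  intro o
  by_cases ho : o ∈ A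
  · simp [ho]
  · simp [ho]

/-- The sum over `A ∋ main` is the term of `main` plus the sum over `A ∖ {main}`. -/
theorem tsum_indicator_eq_add (E : OrbitExpansion Orbit pairing term) (K : Level) (γ : Tr K) (A : Set Orbit)
    {main : Orbit} (hmain : main ∈ A) :
    (∑' o : Orbit, if o ∈ A then term K γ o else 0) =
      term K γ main + ∑' o : Orbit, if o ∈ A ∧ o ≠ main then term K γ o else 0 := by
  have hs := E.summable_indicator K γ A
  rw [hs.tsum_eq_add_tsum_ite main]
  simp only [hmain, if_true]
  congr 1
  refine tsum_congr fun o => ?_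
  by_cases ho : o = main
  · simp [ho]
  · by_cases hA : o ∈ A
    · simp [ho, hA]
    · simp [ho, hA]

/-- **POSITIVITY AT ONE ORBIT + A REMAINDER BOUND GIVE THE SUM CLAUSE** at one level and translate: if the real part of
the term of `main ∈ A` is `≥ m` and the sum over `A ∖ {main}` has norm `≤ (1/2) · Re (term main)`, then the real part of
the sum over `A` is `≥ m / 2`. -/
theorem re_tsum_indicator_ge (E : OrbitExpansion Orbit pairing term) (K : Level) (γ : Tr K) (A : Set Orbit)
    {main : Orbit} (hmain : main ∈ A) {m : ℝ} (hm : m ≤ (term K γ main).re)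
    (hrem : ‖∑' o : Orbit, if o ∈ A ∧ o ≠ main then term K γ o else 0‖ ≤ (1 / 2) * (term K γ main).re) :
    m / 2 ≤ (∑' o : Orbit, if o ∈ A then term K γ o else 0).re := by
  rw [E.tsum_indicator_eq_add K γ A hmain, Complex.add_re]
  set R : ℂ := ∑' o : Orbit, if o ∈ A ∧ o ≠ main then term K γ o else 0 with hR
  have h1 : -R.re ≤ ‖R‖ := (neg_le_abs _).trans (Complex.abs_re_le_norm R)
  linarith

/-- **THE SUM CLAUSE OF `LocalizerSumOff` FROM POSITIVITY AT THE MAIN ORBIT AND A REMAINDER BOUND** (eventual form):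
`main_lower` (the real part of the main term is eventually `≥ m > 0`) and `remainder` (the family minus the main orbit is
eventually of norm `≤ (1/2) · Re (term main)`) give `main_sum_lower` for `mainSet := A`. -/
theorem main_sum_lower_of_remainder (E : OrbitExpansion Orbit pairing term) (A : Set Orbit) {main : Orbit}
    (hmain : main ∈ A) (level : ℕ → Level) (loc : ∀ N : ℕ, Tr (level N))
    (hlower : ∃ m : ℝ, 0 < m ∧ ∀ᶠ N in atTop, m ≤ (term (level N) (loc N) main).re)
    (hrem : ∀ᶠ N in atTop, ‖∑' o : Orbit, if o ∈ A ∧ o ≠ main then term (level N) (loc N) o else 0‖ ≤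
      (1 / 2) * (term (level N) (loc N) main).re) :
    ∃ m : ℝ, 0 < m ∧ ∀ᶠ N in atTop, m ≤ (∑' o : Orbit, if o ∈ A then term (level N) (loc N) o else 0).re := by
  obtain ⟨m, hm, hev⟩ := hlower
  refine ⟨m / 2, by positivity, ?_⟩
  filter_upwards [hev, hrem] with N hN hRN
  exact E.re_tsum_indicator_ge (level N) (loc N) A hmain hN hRN

end OrbitExpansion

end Assembly

end Summit.Ventures.HodgeRepro.Tier4.Line3

end

/-! ## APPENDIX (append-only, t4-x2 g2; t4-plan-3 g3 S13557 cut (1)): the θ-form remainder from an `N`-free majorant -/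

noncomputable section

namespace Summit.Ventures.HodgeRepro.Tier4.Line3

open Filter Topology

open scoped Classical

section Assembly

variable {Level : Type} {Tr : Level → Type}

namespace OrbitExpansion

variable {Orbit : Type} {pairing : ∀ K : Level, Tr K → ℂ} {term : ∀ K : Level, Tr K → Orbit → ℂ}

/-- **THE REMAINDER CLAUSE FROM AN `N`-FREE SUMMABLE MAJORANT** (t4-plan-3 g3 S13557 cut (1)): if a summable `w ≥ 0`,
independent of the depth, dominates every term of `A ∖ {main}` at every depth, `∑' w ≤ θ · m` and `m ≤ Re (term main)`
eventually, then the family minus the main orbit has norm `≤ θ · Re (term main)` eventually — the θ-form `remainder` of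
`LocMU`, whose honest display then carries `{w, θ}` and no `N`. -/
theorem remainder_of_uniform_majorant (A : Set Orbit) {main : Orbit}
    (level : ℕ → Level) (loc : ∀ N : ℕ, Tr (level N)) (w : Orbit → ℝ) (hw0 : ∀ o, 0 ≤ w o) (hws : Summable w)
    (hwle : ∀ (N : ℕ) (o : Orbit), o ∈ A → o ≠ main → ‖term (level N) (loc N) o‖ ≤ w o)
    {θ m : ℝ} (hsum : ∑' o, w o ≤ θ * m) (hm : 0 < m)
    (hlower : ∀ᶠ N in atTop, m ≤ (term (level N) (loc N) main).re) :
    ∀ᶠ N in atTop, ‖∑' o : Orbit, if o ∈ A ∧ o ≠ main then term (level N) (loc N) o else 0‖ ≤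
      θ * (term (level N) (loc N) main).re := by
  -- `θ ≥ 0` since `∑' w ≥ 0` and `m > 0`
  have hθ : 0 ≤ θ := by
    have h0 : 0 ≤ ∑' o, w o := tsum_nonneg hw0
    by_contra hneg
    push Not at hneg
    have : θ * m < 0 := mul_neg_of_neg_of_pos hneg hm
    linarith
  filter_upwards [hlower] with N hN
  -- the restricted summand is dominated by `w`, termwise
  have hdom : ∀ o : Orbit, ‖(if o ∈ A ∧ o ≠ main then term (level N) (loc N) o else 0)‖ ≤ w o := by
    intro o
    by_cases h : o ∈ A ∧ o ≠ main
    · rw [if_pos h]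
      exact hwle N o h.1 h.2
    · rw [if_neg h, norm_zero]
      exact hw0 o
  have h1 : ‖∑' o : Orbit, if o ∈ A ∧ o ≠ main then term (level N) (loc N) o else 0‖ ≤ ∑' o, w o :=
    tsum_of_norm_bounded hws.hasSum hdom
  calc ‖∑' o : Orbit, if o ∈ A ∧ o ≠ main then term (level N) (loc N) o else 0‖
      ≤ ∑' o, w o := h1
    _ ≤ θ * m := hsum
    _ ≤ θ * (term (level N) (loc N) main).re := mul_le_mul_of_nonneg_left hN hθ

/-- **THE θ-FORM REMAINDER GIVES THE SUM CLAUSE** (the `LocMU.family_lower` logic, on the abstract expansion): for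
`θ < 1`, `Re (term main) ≥ m` and `‖family ∖ main‖ ≤ θ · Re (term main)` eventually give `Re Σ_A ≥ (1 − θ) m`. -/
theorem main_sum_lower_of_remainder_theta (E : OrbitExpansion Orbit pairing term) (A : Set Orbit) {main : Orbit}
    (hmain : main ∈ A) (level : ℕ → Level) (loc : ∀ N : ℕ, Tr (level N)) {θ : ℝ} (hθ : θ < 1)
    (hlower : ∃ m : ℝ, 0 < m ∧ ∀ᶠ N in atTop, m ≤ (term (level N) (loc N) main).re)
    (hrem : ∀ᶠ N in atTop, ‖∑' o : Orbit, if o ∈ A ∧ o ≠ main then term (level N) (loc N) o else 0‖ ≤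
      θ * (term (level N) (loc N) main).re) :
    ∃ m : ℝ, 0 < m ∧ ∀ᶠ N in atTop, m ≤ (∑' o : Orbit, if o ∈ A then term (level N) (loc N) o else 0).re := by
  obtain ⟨m, hm, hev⟩ := hlower
  refine ⟨(1 - θ) * m, mul_pos (by linarith) hm, ?_⟩
  filter_upwards [hev, hrem] with N hN hRN
  rw [E.tsum_indicator_eq_add (level N) (loc N) A hmain, Complex.add_re]
  set R : ℂ := ∑' o : Orbit, if o ∈ A ∧ o ≠ main then term (level N) (loc N) o else 0 with hR
  have h1 : -R.re ≤ ‖R‖ := (neg_le_abs _).trans (Complex.abs_re_le_norm R)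
  have hθm : θ * m ≤ θ * (term (level N) (loc N) main).re ∨ θ < 0 := by
    by_cases hθ0 : 0 ≤ θ
    · exact Or.inl (mul_le_mul_of_nonneg_left hN hθ0)
    · exact Or.inr (by push Not at hθ0; exact hθ0)
  rcases hθm with h | h
  · nlinarith
  · nlinarith [norm_nonneg R]

end OrbitExpansion

end Assembly

end Summit.Ventures.HodgeRepro.Tier4.Line3

end
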